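import Summits.CriticalPhenomena.PercolationContinuityZ3.Theorems.SahiMasterFamilyPCDZeroFlag

/-!
# The principal-cap dichotomy, VI: zero families on the principal-cap class are SUPPORT ZERO FLAGS (p-free), every order

Support file of the master-family programme (crux `NoHeavyLowerTail`, stmt-CriticalPhenomena-4575; cell `prim-masterthm`, seat P4,
unit `prim-masterthm-p4-g6`).  Seat document HOME/prim-masterthm-p4/P4-GEN6-REPORT.md.  Strengthens `SahiMasterFamilyPCDZeroFlag`:
there the flag was a `SahiZeroFlag` of each weight `spw w p` separately; here it is the p-FREE, purely combinatorial support class,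
the `Finset` twin of the tree's `SuppZeroFlag` (`SahiMasterFamily.lean`, the conjectured equality locus `Z_k` of the master family):

* `FDetBy U S` — the event `U ⊆ 2^ι` (configurations = finsets of open coordinates) is determined by the coordinates in `S`;
* `FinSuppZeroFlag k U` — `Z_2` = the two events are determined by DISJOINT coordinate sets; `Z_{k+3}` = for some slot `i`, the deleted
  family and every modified family (`U_l ↦ U_l ∩ U_i`) lie in `Z_{k+2}` (verbatim the recursion of `SuppZeroFlag`);
* `finSuppZeroFlag_cyl` — pairwise disjoint cylinder families lie in `Z_{n+2}`;
* **`finSuppZeroFlag_of_principalCap`** — for every order `n + 1`: a principal-cap family of increasing events (`⋂ U_i = ↑c`, up-closed,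
  `∅ ∉ U_i`) with `Λ(U) = 0` lies in `Z_{n+1}`.  With `lambdaSys_eq_zero_of_forall_sahiE_eq_zero`:
  **`finSuppZeroFlag_of_forall_sahiE_eq_zero`** — on the principal-cap class, `E_{n+1}(spw w p; 1_U) ≡ 0 ⟹ U ∈ Z_{n+1}`: the `⇒` direction of
  the master equality conjecture (identically-zero form, cf. `MasterFamilyIdentEqIff`) ON THE PRINCIPAL-CAP CLASS, FOR EVERY ORDER, in the
  `Finset` vocabulary of the sparse-end files (the `Set`/`bernoulliWeight` bridge is routine bookkeeping and left to a companion file).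
HONEST FRAMING: identically-zero locus only, principal-cap class only; Sahi `C_k` [Sahi2008, Conj. 5] / Kahn Conj. 5 / the pointwise
equality conjecture remain OPEN.  [this work]
-/

namespace Summit.CriticalPhenomena.PercolationContinuityZ3.Theorems

namespace SahiSparseEnd

open Finset Function SahiRepresentativeForm
open Literature.Combinatorics.Sahi2008

universe u

variable {ι : Type*} [DecidableEq ι]

/-! ### Support-determined events and the support zero-flag class -/

/-- `U` is DETERMINED BY the coordinates in `S`: `ω ∈ U ↔ ω ∩ S ∈ U`. [this work] -/
def FDetBy (U : Finset (Finset ι)) (S : Finset ι) : Prop := ∀ ω : Finset ι, ω ∈ U ↔ ω ∩ S ∈ U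

/-- **The support zero-flag class `Z_k`** (the `Finset` twin of `SuppZeroFlag`): order `2` = determined by disjoint coordinate sets; order
`k + 3` = some slot can be peeled with the deleted family and all modified families in `Z_{k+2}`; orders `0`, `1` as in the tree. [this work] -/
def FinSuppZeroFlag : (k : ℕ) → (Fin k → Finset (Finset ι)) → Prop
  | 0, _ => True
  | 1, U => U 0 = ∅
  | 2, U => ∃ S T : Finset ι, Disjoint S T ∧ FDetBy (U 0) S ∧ FDetBy (U 1) T
  | k + 3, U => ∃ i : Fin (k + 3), FinSuppZeroFlag (k + 2) (fun j => U (i.succAbove j)) ∧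
      ∀ l : Fin (k + 2), FinSuppZeroFlag (k + 2) (update (fun j => U (i.succAbove j)) l (U (i.succAbove l) ∩ U i))

/-- A cylinder `{ω : A ⊆ ω}` is determined by `A`. [this work] -/
theorem fDetBy_cyl [Fintype ι] (A : Finset ι) : FDetBy (univ.filter fun ω => A ⊆ ω) A := by
  intro ω
  rw [mem_cyl, mem_cyl]
  exact ⟨fun h => subset_inter h subset_rfl, fun h => h.trans inter_subset_left⟩

/-- **Pairwise disjoint cylinder families are support zero flags** of every order `≥ 2` (peel slot `0`; `cyl κ_l ∩ cyl κ_0 = cyl (κ_l ∪ κ_0)`).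
[this work] -/
theorem finSuppZeroFlag_cyl [Fintype ι] : ∀ (n : ℕ) (κ : Fin (n + 2) → Finset ι),
    (∀ i j, i ≠ j → Disjoint (κ i) (κ j)) → FinSuppZeroFlag (n + 2) (fun j => univ.filter fun ω => κ j ⊆ ω)
  | 0, κ, hκ => ⟨κ 0, κ 1, hκ 0 1 (by decide), fDetBy_cyl (κ 0), fDetBy_cyl (κ 1)⟩
  | n + 1, κ, hκ => by
    have h0j : ∀ j : Fin (n + 2), (0 : Fin (n + 3)) ≠ (0 : Fin (n + 3)).succAbove j := fun j => (Fin.succAbove_ne 0 j).symm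
    refine ⟨0, ?_, fun l => ?_⟩
    · exact finSuppZeroFlag_cyl n (fun j => κ ((0 : Fin (n + 3)).succAbove j)) fun i j hij =>
        hκ _ _ fun h => hij (Fin.succAbove_right_injective h)
    · have hfam : update (fun j => univ.filter fun ω => κ ((0 : Fin (n + 3)).succAbove j) ⊆ ω) l
          ((univ.filter fun ω => κ ((0 : Fin (n + 3)).succAbove l) ⊆ ω) ∩ (univ.filter fun ω => κ 0 ⊆ ω)) =
          fun j => univ.filter fun ω =>
            update (fun j => κ ((0 : Fin (n + 3)).succAbove j)) l (κ ((0 : Fin (n + 3)).succAbove l) ∪ κ 0) j ⊆ ω := by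
        funext j
        rw [update_apply, update_apply]
        split_ifs with h
        · rw [cyl_inter]
        · rfl
      rw [hfam]
      refine finSuppZeroFlag_cyl n _ fun i j hij => ?_
      rw [update_apply, update_apply]
      split_ifs with hi hj hj
      · exact absurd (hi.trans hj.symm) hij
      · rw [disjoint_union_left]
        exact ⟨hκ _ _ fun h => hij (hi.trans (Fin.succAbove_right_injective h)), hκ _ _ (h0j j)⟩
      · rw [disjoint_union_right]
        exact ⟨hκ _ _ fun h => hij ((Fin.succAbove_right_injective h).trans hj.symm), (hκ _ _ (h0j i)).symm⟩
      · exact hκ _ _ fun h => hij (Fin.succAbove_right_injective h)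

/-! ### Principal-cap zero families are support zero flags -/

/-- Case A packaged: if every singleton block is good, the family IS a family of pairwise disjoint cylinders. [this work] -/
theorem exists_eq_cyl_of_forall_singleton_good {ι : Type u} [Fintype ι] [DecidableEq ι] {n : ℕ} {U : Fin (n + 2) → Finset (Finset ι)}
    (hU : ∀ i a a', a ∈ U i → a ⊆ a' → a' ∈ U i) {c : Finset ι} (hpc : IsPrincipalCap U c)
    (hall : ∀ j, ({j} : Finset (Fin (n + 2))) ∈ goodBlocks (Fc U c) c) :
    ∃ κ : Fin (n + 2) → Finset ι, (∀ i j, i ≠ j → Disjoint (κ i) (κ j)) ∧ U = fun i => univ.filter fun ω => κ i ⊆ ω := by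
  have hupF := Fc_upClosed (c := c) hU
  have hcapF := Fc_cap_of_principalCap hpc
  have hQ : ∀ A ∈ goodBlocks (Fc U c) c, ∀ B ∈ goodBlocks (Fc U c) c, A ∪ B ∈ goodBlocks (Fc U c) c :=
    fun A hA B hB => goodBlocks_union hupF hA hB
  have herase : ∀ j : Fin (n + 2), univ.erase j ∈ goodBlocks (Fc U c) c := by
    intro j
    have hne : (univ.erase j : Finset (Fin (n + 2))).Nonempty := card_pos.1 (by
      rw [card_erase_of_mem (mem_univ j), Finset.card_univ, Fintype.card_fin]; omega)
    have h := biUnion_mem_of_unionClosed hQ ((univ.erase j).image fun l => ({l} : Finset (Fin (n + 2))))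
      (fun A hA => by obtain ⟨l, -, rfl⟩ := mem_image.1 hA; exact hall l) (hne.image _)
    have heq : ((univ.erase j).image fun l => ({l} : Finset (Fin (n + 2)))).biUnion id = univ.erase j := by
      ext l; simp
    rwa [heq] at h
  have hst := fun j => core_erase_of_good hupF hcapF (herase j)
  refine ⟨fun i => core (Fc U c) c {i}, fun l j hlj => (hst j).2.2 l hlj, funext fun j => ?_⟩
  exact eq_cyl_of_principal hU hpc j (hst j).2.1 ((mem_FR.1 (mem_goodBlocks.1 (hall j)).2.1).2 j (mem_singleton_self j))

/-- **PRINCIPAL-CAP ZERO FAMILIES ARE SUPPORT ZERO FLAGS, EVERY ORDER.**  A principal-cap family of `n + 1` increasing events (up-closed,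
`∅ ∉ U_i`, `⋂ U_i = ↑c`) with `Λ(U) = 0` lies in `Z_{n+1}` (`FinSuppZeroFlag`). [this work] -/
theorem finSuppZeroFlag_of_principalCap : ∀ (n : ℕ) {ι : Type u} [Fintype ι] [DecidableEq ι] (U : Fin (n + 1) → Finset (Finset ι))
    (c : Finset ι), (∀ i a a', a ∈ U i → a ⊆ a' → a' ∈ U i) → (∀ i, ∅ ∉ U i) → IsPrincipalCap U c → LambdaSys (Fc U c) c = 0 →
    FinSuppZeroFlag (n + 1) U
  | 0, ι, _, _, U, c, _, _, hpc, hΛ => by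
    exfalso
    have hc : c ∈ Fc U c 0 := mem_filter.2 ⟨(hpc c).2 subset_rfl 0, subset_rfl⟩
    have h1 := lambdaSys_fin_one (Fc U c) c hc
    rw [hΛ] at h1
    exact zero_ne_one h1
  | 1, ι, _, _, U, c, hU, h0, hpc, hΛ => by
    by_cases hall : ∀ j, ({j} : Finset (Fin 2)) ∈ goodBlocks (Fc U c) c
    · obtain ⟨κ, hκ, rfl⟩ := exists_eq_cyl_of_forall_singleton_good hU hpc hall
      exact finSuppZeroFlag_cyl 0 κ hκ
    · -- case B at order two: the deleted family has order one and `Λ = 1` — impossible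
      exfalso
      push Not at hall
      obtain ⟨i, hi⟩ := hall
      obtain ⟨c', hpc', hΛ'⟩ := exists_principalCap_delete hU h0 hpc hΛ i hi
      have hc : c' ∈ Fc (fun j => U (i.succAbove j)) c' 0 := mem_filter.2 ⟨(hpc' c').2 subset_rfl 0, subset_rfl⟩
      have h1 := lambdaSys_fin_one (Fc (fun j => U (i.succAbove j)) c') c' hc
      rw [hΛ'] at h1
      exact zero_ne_one h1
  | n + 2, ι, _, _, U, c, hU, h0, hpc, hΛ => by
    by_cases hall : ∀ j, ({j} : Finset (Fin (n + 3))) ∈ goodBlocks (Fc U c) c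
    · obtain ⟨κ, hκ, rfl⟩ := exists_eq_cyl_of_forall_singleton_good hU hpc hall
      exact finSuppZeroFlag_cyl (n + 1) κ hκ
    · push Not at hall
      obtain ⟨i, hi⟩ := hall
      obtain ⟨c', hpc', hΛ'⟩ := exists_principalCap_delete hU h0 hpc hΛ i hi
      have hdelZ : FinSuppZeroFlag (n + 2) (fun j => U (i.succAbove j)) :=
        finSuppZeroFlag_of_principalCap (n + 1) (fun j => U (i.succAbove j)) c' (fun j => hU _) (fun j => h0 _) hpc' hΛ'
      have hdel : ∀ q : ℝ, sahiE (spw (fun _ => (1 : ℝ)) q) (n + 2) (fun j => setInd (U (i.succAbove j))) = 0 :=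
        fun q => sahiE_eq_zero_of_sahiZeroFlag _ _ _
          (sahiZeroFlag_of_principalCap (n + 1) (fun j => U (i.succAbove j)) c' (fun j => hU _) (fun j => h0 _) hpc' hΛ' _ q)
      have hsum := lambdaSys_eq_sum_peelFam hU h0 hpc hdel
      rw [hΛ, Int.cast_zero] at hsum
      have hVU : ∀ l, ∀ j a a', a ∈ peelFam U i l j → a ⊆ a' → a' ∈ peelFam U i l j := fun l => peelFam_up hU l
      have hV0 : ∀ l j, ∅ ∉ peelFam U i l j := fun l => peelFam_empty_not_mem h0 l
      have hVpc : ∀ l, IsPrincipalCap (peelFam U i l) c := fun l => peelFam_principalCap hpc l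
      have hnn : ∀ l ∈ (univ : Finset (Fin (n + 2))), (0 : ℝ) ≤ (LambdaSys (Fc (peelFam U i l) c) c : ℝ) := fun l _ =>
        Int.cast_nonneg (lambdaSys_Fc_nonneg (peelFam U i l) (hVU l) (hV0 l) ⟨c, (hVpc l).self_mem_common⟩
          ((hVpc l).mem_commonMin _))
      have hzero := (sum_eq_zero_iff_of_nonneg hnn).1 hsum.symm
      exact ⟨i, hdelZ, fun l => finSuppZeroFlag_of_principalCap (n + 1) (peelFam U i l) c (hVU l) (hV0 l) (hVpc l)
        (by exact_mod_cast hzero l (mem_univ l))⟩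

/-- **On the principal-cap class, identically-zero families are support zero flags** (every order): if `E_{n+1}(spw w p; 1_U) = 0` for
all `w`, `p` then `U ∈ Z_{n+1}`. [this work] -/
theorem finSuppZeroFlag_of_forall_sahiE_eq_zero {ι : Type u} [Fintype ι] [DecidableEq ι] {n : ℕ} (U : Fin (n + 1) → Finset (Finset ι))
    (c : Finset ι) (hU : ∀ i a a', a ∈ U i → a ⊆ a' → a' ∈ U i) (h0 : ∀ i, ∅ ∉ U i) (hpc : IsPrincipalCap U c)
    (hE : ∀ (w : ι → ℝ) (p : ℝ), sahiE (spw w p) (n + 1) (fun i => setInd (U i)) = 0) : FinSuppZeroFlag (n + 1) U :=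
  finSuppZeroFlag_of_principalCap n U c hU h0 hpc (lambdaSys_eq_zero_of_forall_sahiE_eq_zero U hU h0 hpc (hE _))

end SahiSparseEnd

end Summit.CriticalPhenomena.PercolationContinuityZ3.Theorems
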